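import Mathlib
import HarnessLib
import Literature.MathematicalPhysics.StatisticalMechanics.LennardJonesClusters
import Summits.AtomisticToContinuum.Crystallization.Theorems.ContactSaturationLadderDilationCharge

/-!
# ContactSaturationLadder · `LooseTextureRung` (stmt-AtomisticToContinuum-30303) — the DISPERSION CHARGE and the MERIT SPLIT of a window

Helper module for the crux `Summit.AtomisticToContinuum.Crystallization.Theses.ContactSaturationLadder.LooseTextureRung`
(registered skeleton v6.3 «DialFreeSieveV6», stub `stub_corelessLaw6` = the CORELESS LAW CL; decomp-a2c lens-1 g27,
critic row 344 (2): «a NON-affine charge on self-equilibrated coreless textures that is NOT a per-site shell sum, `e⋆`-free»).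
It continues the strain-mode ladder of `…DilationCharge` (rung 1, window dilatation) one scale DOWN — to the
particle-to-particle mismatch of personal equilibrium scales — by an exact, configuration-free identity.

## Notation (nothing is defined; all sums are window-internal, ordered pairs inside `W`)
For distinct points `y : Fin N → ℝ³`, an index set `W`, `n = #W`, and a site `i ∈ W`:
`b_i = Σ_{k∈W∖i} r_ik⁻¹²`, `a_i = Σ_{k∈W∖i} r_ik⁻⁶` (SITE lattice sums), `S₁₂ = Σ_i b_i`, `S₆ = Σ_i a_i` (WINDOW lattice sums),
`u_i = a_i/b_i` (PERSONAL RATIO: `u_i^{1/6}` is the dilation that would put site `i` alone at its mechanical equilibrium;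
`a_i − b_i` is the site's personal virial), `ū = S₆/S₁₂` (the window's), `q_i = a_i²/b_i` (SITE MERIT: `−q_i/24` is the
energy site `i` would have at its personal optimal dilation), `Q = S₆²/(S₁₂·n)` (WINDOW MERIT: `−Q·n/24 = min_t 𝓔(t·y|W)`),
`𝓔(y|W) = ½ΣΣ V_LJ = S₁₂/24 − S₆/12`, `e⋆ = ⨅_Q e(Q)`, `M⋆ = −24·e⋆` (the CRYSTAL MERIT; `Q ≤ M⋆` for every finite
window is the periodisation floor), `X(y|W) = 𝓔(y|W) − n·e⋆` (window excess).

## What is proved (GS-free §1–§3, GS grade §4, counting §5)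

* §1 `sum_sq_div_eq_variance` — the weighted Cauchy–Schwarz inequality WITH ITS DEFECT (pure algebra on a finset):
  `Σ a²/b = (Σa)²/(Σb) + Σ b·(a/b − Σa/Σb)²`; `three_term_identity`: for every real `e`,
  `Σb/24 − Σa/12 − n·e = (Σb − Σa)²/(24Σb) + (1/24)·Σ b(a/b − ū)² + (1/24)·Σ_i (−24e − a_i²/b_i)`.
* §2 `windowEnergy_three_terms` — THE MERIT SPLIT of a window, for EVERY configuration, index set and reference level `e`:
      `𝓔(y|W) − n·e = T₁ + T₂ + (1/24)·Σ_{i∈W} (−24e − q_i)`,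
  `T₁ = (S₁₂ − S₆)²/(24·S₁₂)` = the DILATION CHARGE of rung 1 (the only scale-dependent term),
  `T₂ = (1/24)·Σ_i b_i (u_i − ū)²` = the DISPERSION CHARGE (NEW): the `b`-weighted variance of the personal ratios —
  dilation-invariant, `e⋆`-free, numerals only, `≥ 0` (`dispersionCharge_nonneg`), vanishing iff all sites of the window share
  one personal equilibrium scale («isobaric window»); it is a TWO-POINT statistic (`Σb·T₂·24 = ½ΣΣ b_i b_k (u_i − u_k)²`), not a
  per-site floor, so the per-site ceiling `siteFloor_seven_tenths_lt` (lens-1 §34) does not apply to it;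
  third term = the MEAN-SITE-MERIT term.  Corollary `windowMerit_le_siteMerits`: `S₆²/S₁₂ ≤ Σ_i q_i` (window merit ≤ mean
  site merit, equality iff isobaric).
* §3 with `e = e⋆`: `siteMeritSurplus_le_strainCharges` — `(1/24)·Σ_i (q_i − M⋆) ≤ T₁ + T₂` (the floor `X ≥ 0` read through
  the split: site-merit surplus over the crystal merit is paid for by the two strain charges; an isobaric balanced window has
  NO merit-surplus on average); `strainCharges_sub_surplus_le_excess` — the `e⋆`-FREE MASTER INEQUALITY: for every `q₀ ≥ e⋆`
  (tree: `q₀ = −0.7175`, `OnePercentFccWindow.eStar_le`, certified fcc lattice sum; `q₀ = −0.711` kernel-only),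
      `T₁ + T₂ − (1/24)·Σ_i (q_i + 24·q₀) ≤ X(y|W)`,
  i.e. CL's currency `X` dominates dilation + dispersion minus the site-merit surplus over `M₀ = −24q₀` (`= 17.22`, the fcc/hcp
  merit to `10⁻⁴`).
* §4 GS GRADE (`gsStrainCharges_le_surplus`, `gsStrainCharges_le_surplus_free`): for every `ε > 0` there is `ρ₁` such that for
  all `ρ ≥ ρ₁`, every Lennard-Jones ground state and every centre, on `B = B(p,ρ)`:
      `T₁(B) + T₂(B) ≤ (1/24)·Σ_{i∈B}(q_i − M⋆) + ε·(#B + ρ³) ≤ (1/24)·Σ_{i∈B}(q_i − M₀) + ε·(#B + ρ³)`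
  — the new NECESSARY LAW «personal-scale dispersion (atomic-level pressure inhomogeneity) in a ground-state window is paid for
  ONLY by site-merit surplus»: a texture whose dispersion density exceeds its merit-surplus density cannot fill large
  ground-state windows.  (From the split and the window ceiling `gsWindow_excess_virial`.)
* §5 `card_mul_le_dispersion` — COUNTING FORM of the dispersion charge (abstract finsets): if each charged index `j ∈ J` sees,
  inside a set `P j` of multiplicity `≤ K`, two sites with weights `≥ β` and personal ratios `≥ c` apart, then
  `#J·βc²/(2K) ≤ Σ_i b_i(u_i − m)²` for every centre `m` — the localisation used by the node's «pressure-contrasted» class.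

## Why this is a rung and not CL (honest scope)
`T₂` prices only personal-scale CONTRAST; the third term carries the sign difficulty of the crystal problem: a site can have
merit above `M⋆` (e.g. the 16-coordinated site of monatomic C15), so `T₂ ≤ X` is NOT a theorem — only `T₂ ≤ X + surplus` is
(§3–§4).  CL on balanced coreless textures is thereby CUT into a dispersion channel (proved charge) and a mean-site-merit
channel («isobaric or merit-surplus polytetrahedral textures»: species energetics, instrumentable structure by structure as
certified lattice sums `q_i`, `u_i` per site class) — see the lens-1 node §37.
-/

namespace Summit.AtomisticToContinuum.Crystallization.Theorems.ContactSaturationLadderDispersionCharge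

open scoped BigOperators Classical
open Literature.MathematicalPhysics.StatisticalMechanics (lennardJones IsGroundState PeriodicConfiguration)
open Summit.AtomisticToContinuum.Crystallization.Theorems.ContactSaturationLadderWindowFloor (card_mul_iInf_le_half_sum)
open Summit.AtomisticToContinuum.Crystallization.Theorems.ContactSaturationLadderDilationCharge (half_sum_lennardJones_eq
  windowExcess_nonneg gsWindow_excess_virial)

/-! ## §1 Algebra on a finset: Cauchy–Schwarz with its defect, the three-term identity -/

/-- **Weighted variance identity (Cauchy–Schwarz / Sedrakyan with its defect).**  For reals `a i` and weights `b i ≥ 0` on a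
finset with `b i = 0 → a i = 0`: `Σ a²/b = (Σa)²/(Σb) + Σ b·(a/b − Σa/Σb)²` (Lean's `x/0 = 0` throughout). -/
theorem sum_sq_div_eq_variance {ι : Type*} (s : Finset ι) (a b : ι → ℝ) (hb : ∀ i ∈ s, 0 ≤ b i)
    (hab : ∀ i ∈ s, b i = 0 → a i = 0) :
    ∑ i ∈ s, a i ^ 2 / b i =
      (∑ i ∈ s, a i) ^ 2 / (∑ i ∈ s, b i) +
        ∑ i ∈ s, b i * (a i / b i - (∑ i ∈ s, a i) / (∑ i ∈ s, b i)) ^ 2 := by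
  set A : ℝ := ∑ i ∈ s, a i with hA
  set B : ℝ := ∑ i ∈ s, b i with hB
  have key : ∀ c : ℝ, ∑ i ∈ s, b i * (a i / b i - c) ^ 2 = ∑ i ∈ s, a i ^ 2 / b i - 2 * c * A + c ^ 2 * B := by
    intro c
    have ht : ∀ i ∈ s, b i * (a i / b i - c) ^ 2 = a i ^ 2 / b i - 2 * c * a i + c ^ 2 * b i := by
      intro i hi
      by_cases hbi : b i = 0
      · have hai : a i = 0 := hab i hi hbi
        simp [hbi, hai]
      · field_simp
        ring
    rw [Finset.sum_congr rfl ht, Finset.sum_add_distrib, Finset.sum_sub_distrib, ← Finset.mul_sum, ← Finset.mul_sum]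
  by_cases hB0 : B = 0
  · have hbi : ∀ i ∈ s, b i = 0 := fun i hi => (Finset.sum_eq_zero_iff_of_nonneg hb).1 (hB ▸ hB0) i hi
    have hai : ∀ i ∈ s, a i = 0 := fun i hi => hab i hi (hbi i hi)
    have h1 : ∑ i ∈ s, a i ^ 2 / b i = 0 := Finset.sum_eq_zero fun i hi => by simp [hai i hi]
    have h2 : ∑ i ∈ s, b i * (a i / b i - A / B) ^ 2 = 0 := Finset.sum_eq_zero fun i hi => by simp [hbi i hi]
    rw [h1, h2, hB0]; simp
  · rw [key (A / B)]
    field_simp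
    ring

/-- Sedrakyan–Engel form of Cauchy–Schwarz: `(Σa)²/(Σb) ≤ Σ a²/b` (the defect in `sum_sq_div_eq_variance` is `≥ 0`). -/
theorem sq_sum_div_le_sum_sq_div {ι : Type*} (s : Finset ι) (a b : ι → ℝ) (hb : ∀ i ∈ s, 0 ≤ b i)
    (hab : ∀ i ∈ s, b i = 0 → a i = 0) :
    (∑ i ∈ s, a i) ^ 2 / (∑ i ∈ s, b i) ≤ ∑ i ∈ s, a i ^ 2 / b i := by
  rw [sum_sq_div_eq_variance s a b hb hab]
  have : 0 ≤ ∑ i ∈ s, b i * (a i / b i - (∑ i ∈ s, a i) / (∑ i ∈ s, b i)) ^ 2 :=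
    Finset.sum_nonneg fun i hi => mul_nonneg (hb i hi) (sq_nonneg _)
  linarith

/-- **Three-term identity.**  For every real `e`:
`Σb/24 − Σa/12 − #s·e = (Σb − Σa)²/(24Σb) + (1/24)Σ b(a/b − Σa/Σb)² + (1/24)Σ_i(−24e − a_i²/b_i)`. -/
theorem three_term_identity {ι : Type*} (s : Finset ι) (a b : ι → ℝ) (hb : ∀ i ∈ s, 0 ≤ b i)
    (hab : ∀ i ∈ s, b i = 0 → a i = 0) (e : ℝ) :
    (∑ i ∈ s, b i) / 24 - (∑ i ∈ s, a i) / 12 - (s.card : ℝ) * e =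
      ((∑ i ∈ s, b i) - ∑ i ∈ s, a i) ^ 2 / (24 * ∑ i ∈ s, b i) +
        (1 / 24) * ∑ i ∈ s, b i * (a i / b i - (∑ i ∈ s, a i) / (∑ i ∈ s, b i)) ^ 2 +
          (1 / 24) * ∑ i ∈ s, (-24 * e - a i ^ 2 / b i) := by
  have hvar := sum_sq_div_eq_variance s a b hb hab
  set A : ℝ := ∑ i ∈ s, a i with hA
  set B : ℝ := ∑ i ∈ s, b i with hB
  set V : ℝ := ∑ i ∈ s, b i * (a i / b i - A / B) ^ 2 with hV
  have hlast : ∑ i ∈ s, (-24 * e - a i ^ 2 / b i) = -24 * e * (s.card : ℝ) - ∑ i ∈ s, a i ^ 2 / b i := by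
    rw [Finset.sum_sub_distrib, Finset.sum_const, nsmul_eq_mul]; ring
  rw [hlast, hvar]
  by_cases hB0 : B = 0
  · have hbi : ∀ i ∈ s, b i = 0 := fun i hi => (Finset.sum_eq_zero_iff_of_nonneg hb).1 (hB ▸ hB0) i hi
    have hA0 : A = 0 := by rw [hA]; exact Finset.sum_eq_zero fun i hi => hab i hi (hbi i hi)
    rw [hB0, hA0]; simp; ring
  · field_simp
    ring

/-! ## §2 The merit split of a window (GS-free, configuration-free) -/

/-- Site lattice sums vanish together: `Σ_{k∈W∖i} r⁻¹² = 0 → Σ_{k∈W∖i} r⁻⁶ = 0` (term by term `r⁻¹² = (r⁻⁶)²`). -/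
theorem siteSix_eq_zero_of_siteTwelve {N : ℕ} (y : Fin N → EuclideanSpace ℝ (Fin 3)) (W : Finset (Fin N)) (i : Fin N)
    (h : (∑ k ∈ W.erase i, (dist (y i) (y k))⁻¹ ^ 12) = 0) : (∑ k ∈ W.erase i, (dist (y i) (y k))⁻¹ ^ 6) = 0 := by
  have h' : ∀ k ∈ W.erase i, (dist (y i) (y k))⁻¹ ^ 12 = 0 :=
    (Finset.sum_eq_zero_iff_of_nonneg fun k _ => by positivity).1 h
  refine Finset.sum_eq_zero fun k hk => ?_
  have h0 : (dist (y i) (y k))⁻¹ = 0 := (pow_eq_zero_iff (by norm_num)).1 (h' k hk)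
  rw [h0]; norm_num

/-- **THE MERIT SPLIT OF A WINDOW.**  For every configuration `y`, EVERY index set `W` and every reference level `e`:
`𝓔(y|W) − #W·e = T₁ + T₂ + (1/24)·Σ_{i∈W}(−24e − q_i)` with `T₁ = (S₁₂ − S₆)²/(24S₁₂)` (dilation charge),
`T₂ = (1/24)Σ_i b_i(a_i/b_i − S₆/S₁₂)²` (DISPERSION CHARGE) and `q_i = a_i²/b_i` (site merits). -/
theorem windowEnergy_three_terms {N : ℕ} (y : Fin N → EuclideanSpace ℝ (Fin 3)) (W : Finset (Fin N)) (e : ℝ) :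
    ((1 / 2) * ∑ i ∈ W, ∑ k ∈ W.erase i, lennardJones (dist (y i) (y k))) - (W.card : ℝ) * e =
          ((∑ i ∈ W, ∑ k ∈ W.erase i, (dist (y i) (y k))⁻¹ ^ 12) - (∑ i ∈ W, ∑ k ∈ W.erase i, (dist (y i) (y k))⁻¹ ^ 6)) ^ 2 / (24 *
          (∑ i ∈ W, ∑ k ∈ W.erase i, (dist (y i) (y k))⁻¹ ^ 12)) + (1 / 24) * ∑ i ∈ W, (∑ k ∈ W.erase i, (dist (y i) (y k))⁻¹ ^ 12) *
          ((∑ k ∈ W.erase i, (dist (y i) (y k))⁻¹ ^ 6) / (∑ k ∈ W.erase i, (dist (y i) (y k))⁻¹ ^ 12) -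
          (∑ i ∈ W, ∑ k ∈ W.erase i, (dist (y i) (y k))⁻¹ ^ 6) / (∑ i ∈ W, ∑ k ∈ W.erase i, (dist (y i) (y k))⁻¹ ^ 12)) ^ 2 + (1 / 24) *
          ∑ i ∈ W, (-24 * e - (∑ k ∈ W.erase i, (dist (y i) (y k))⁻¹ ^ 6) ^ 2 / (∑ k ∈ W.erase i, (dist (y i) (y k))⁻¹ ^ 12)) := by
  rw [half_sum_lennardJones_eq y W]
  exact three_term_identity W (fun i => (∑ k ∈ W.erase i, (dist (y i) (y k))⁻¹ ^ 6)) (fun i => (∑ k ∈ W.erase i, (dist (y i) (y k))⁻¹ ^ 12))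
        (fun i _ => by positivity)
    (fun i _ hi => siteSix_eq_zero_of_siteTwelve y W i hi) e

/-- The dispersion charge is non-negative. -/
theorem dispersionCharge_nonneg {N : ℕ} (y : Fin N → EuclideanSpace ℝ (Fin 3)) (W : Finset (Fin N)) :
    0 ≤ (1 / 24) * ∑ i ∈ W, (∑ k ∈ W.erase i, (dist (y i) (y k))⁻¹ ^ 12) *
          ((∑ k ∈ W.erase i, (dist (y i) (y k))⁻¹ ^ 6) / (∑ k ∈ W.erase i, (dist (y i) (y k))⁻¹ ^ 12) -
          (∑ i ∈ W, ∑ k ∈ W.erase i, (dist (y i) (y k))⁻¹ ^ 6) / (∑ i ∈ W, ∑ k ∈ W.erase i, (dist (y i) (y k))⁻¹ ^ 12)) ^ 2 :=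
  mul_nonneg (by norm_num) (Finset.sum_nonneg fun i _ => mul_nonneg (by positivity) (sq_nonneg _))

/-- The dilation charge is non-negative. -/
theorem dilationCharge_nonneg {N : ℕ} (y : Fin N → EuclideanSpace ℝ (Fin 3)) (W : Finset (Fin N)) :
    0 ≤ ((∑ i ∈ W, ∑ k ∈ W.erase i, (dist (y i) (y k))⁻¹ ^ 12) - (∑ i ∈ W, ∑ k ∈ W.erase i, (dist (y i) (y k))⁻¹ ^ 6)) ^ 2 / (24 *
          (∑ i ∈ W, ∑ k ∈ W.erase i, (dist (y i) (y k))⁻¹ ^ 12)) := by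
  positivity

/-- **Window merit ≤ site merits** (Cauchy–Schwarz): `S₆(W)²/S₁₂(W) ≤ Σ_{i∈W} q_i`, i.e. `n·Q(W) ≤ Σ q_i`; equality iff all
personal ratios of the window coincide (isobaric window). -/
theorem windowMerit_le_siteMerits {N : ℕ} (y : Fin N → EuclideanSpace ℝ (Fin 3)) (W : Finset (Fin N)) :
    (∑ i ∈ W, ∑ k ∈ W.erase i, (dist (y i) (y k))⁻¹ ^ 6) ^ 2 / (∑ i ∈ W, ∑ k ∈ W.erase i, (dist (y i) (y k))⁻¹ ^ 12) ≤
          ∑ i ∈ W, (∑ k ∈ W.erase i, (dist (y i) (y k))⁻¹ ^ 6) ^ 2 / (∑ k ∈ W.erase i, (dist (y i) (y k))⁻¹ ^ 12) :=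
  sq_sum_div_le_sum_sq_div W (fun i => (∑ k ∈ W.erase i, (dist (y i) (y k))⁻¹ ^ 6)) (fun i => (∑ k ∈ W.erase i, (dist (y i) (y k))⁻¹ ^ 12))
        (fun i _ => by positivity)
    fun i _ hi => siteSix_eq_zero_of_siteTwelve y W i hi

/-! ## §3 The split at the level `e⋆`: surplus ≤ strain charges; the `e⋆`-free master inequality -/

/-- **Site-merit surplus is paid for by the strain charges.**  For distinct points and every index set:
`(1/24)·Σ_{i∈W}(q_i + 24·e⋆) ≤ T₁ + T₂` — i.e. `(1/24)Σ(q_i − M⋆) ≤ T₁ + T₂` with `M⋆ = −24e⋆`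
(the periodisation floor `X ≥ 0` read through the merit split). -/
theorem siteMeritSurplus_le_strainCharges {N : ℕ} {y : Fin N → EuclideanSpace ℝ (Fin 3)} (hy : Function.Injective y)
    (W : Finset (Fin N)) :
    (1 / 24) * ∑ i ∈ W, ((∑ k ∈ W.erase i, (dist (y i) (y k))⁻¹ ^ 6) ^ 2 / (∑ k ∈ W.erase i, (dist (y i) (y k))⁻¹ ^ 12) + 24 *
          (⨅ Q : PeriodicConfiguration 3, Q.energyPerParticle lennardJones)) ≤ ((∑ i ∈ W, ∑ k ∈ W.erase i, (dist (y i) (y k))⁻¹ ^ 12) -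
          (∑ i ∈ W, ∑ k ∈ W.erase i, (dist (y i) (y k))⁻¹ ^ 6)) ^ 2 / (24 * (∑ i ∈ W, ∑ k ∈ W.erase i, (dist (y i) (y k))⁻¹ ^ 12)) +
          (1 / 24) * ∑ i ∈ W, (∑ k ∈ W.erase i, (dist (y i) (y k))⁻¹ ^ 12) *
          ((∑ k ∈ W.erase i, (dist (y i) (y k))⁻¹ ^ 6) / (∑ k ∈ W.erase i, (dist (y i) (y k))⁻¹ ^ 12) -
          (∑ i ∈ W, ∑ k ∈ W.erase i, (dist (y i) (y k))⁻¹ ^ 6) / (∑ i ∈ W, ∑ k ∈ W.erase i, (dist (y i) (y k))⁻¹ ^ 12)) ^ 2 := by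
  have h3 := windowEnergy_three_terms y W (⨅ Q : PeriodicConfiguration 3, Q.energyPerParticle lennardJones)
  have h0 := windowExcess_nonneg hy W
  have hneg : (1 / 24) * ∑ i ∈ W, (-24 * (⨅ Q : PeriodicConfiguration 3, Q.energyPerParticle lennardJones) -
        (∑ k ∈ W.erase i, (dist (y i) (y k))⁻¹ ^ 6) ^ 2 / (∑ k ∈ W.erase i, (dist (y i) (y k))⁻¹ ^ 12)) = -((1 / 24) *
        ∑ i ∈ W, ((∑ k ∈ W.erase i, (dist (y i) (y k))⁻¹ ^ 6) ^ 2 / (∑ k ∈ W.erase i, (dist (y i) (y k))⁻¹ ^ 12) + 24 *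
        (⨅ Q : PeriodicConfiguration 3, Q.energyPerParticle lennardJones))) := by
    rw [← mul_neg, ← Finset.sum_neg_distrib]
    congr 1
    exact Finset.sum_congr rfl fun i _ => by ring
  linarith

/-- **THE `e⋆`-FREE MASTER INEQUALITY.**  For distinct points, every index set `W` and every real `q₀` with `e⋆ ≤ q₀`
(tree: `q₀ = −7175/10000` from the certified fcc lattice sum `OnePercentFccWindow.eStar_le`):
`T₁ + T₂ − (1/24)·Σ_{i∈W}(q_i + 24·q₀) ≤ X(y|W) = 𝓔(y|W) − #W·e⋆` — dilation + dispersion minus the site-merit surplus over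
`M₀ = −24q₀` is a lower bound for the window excess in CL's own currency. -/
theorem strainCharges_sub_surplus_le_excess {N : ℕ} {y : Fin N → EuclideanSpace ℝ (Fin 3)} (hy : Function.Injective y)
    (W : Finset (Fin N)) {q₀ : ℝ} (hq : (⨅ Q : PeriodicConfiguration 3, Q.energyPerParticle lennardJones) ≤ q₀) :
    ((∑ i ∈ W, ∑ k ∈ W.erase i, (dist (y i) (y k))⁻¹ ^ 12) - (∑ i ∈ W, ∑ k ∈ W.erase i, (dist (y i) (y k))⁻¹ ^ 6)) ^ 2 / (24 *
          (∑ i ∈ W, ∑ k ∈ W.erase i, (dist (y i) (y k))⁻¹ ^ 12)) + (1 / 24) * ∑ i ∈ W, (∑ k ∈ W.erase i, (dist (y i) (y k))⁻¹ ^ 12) *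
          ((∑ k ∈ W.erase i, (dist (y i) (y k))⁻¹ ^ 6) / (∑ k ∈ W.erase i, (dist (y i) (y k))⁻¹ ^ 12) -
          (∑ i ∈ W, ∑ k ∈ W.erase i, (dist (y i) (y k))⁻¹ ^ 6) / (∑ i ∈ W, ∑ k ∈ W.erase i, (dist (y i) (y k))⁻¹ ^ 12)) ^ 2 - (1 / 24) *
          ∑ i ∈ W, ((∑ k ∈ W.erase i, (dist (y i) (y k))⁻¹ ^ 6) ^ 2 / (∑ k ∈ W.erase i, (dist (y i) (y k))⁻¹ ^ 12) + 24 * q₀) ≤ ((1 / 2) *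
          ∑ i ∈ W, ∑ k ∈ W.erase i, lennardJones (dist (y i) (y k))) - (W.card : ℝ) *
          (⨅ Q : PeriodicConfiguration 3, Q.energyPerParticle lennardJones) := by
  have h3 := windowEnergy_three_terms y W q₀
  have hneg : (1 / 24) * ∑ i ∈ W, (-24 * q₀ -
        (∑ k ∈ W.erase i, (dist (y i) (y k))⁻¹ ^ 6) ^ 2 / (∑ k ∈ W.erase i, (dist (y i) (y k))⁻¹ ^ 12)) = -((1 / 24) *
        ∑ i ∈ W, ((∑ k ∈ W.erase i, (dist (y i) (y k))⁻¹ ^ 6) ^ 2 / (∑ k ∈ W.erase i, (dist (y i) (y k))⁻¹ ^ 12) + 24 * q₀)) := by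
    rw [← mul_neg, ← Finset.sum_neg_distrib]
    congr 1
    exact Finset.sum_congr rfl fun i _ => by ring
  have hmono : (W.card : ℝ) * (⨅ Q : PeriodicConfiguration 3, Q.energyPerParticle lennardJones) ≤ (W.card : ℝ) * q₀ :=
        mul_le_mul_of_nonneg_left hq (Nat.cast_nonneg _)
  have _ := hy
  linarith

/-! ## §4 GS grade: strain charges are paid only by merit surplus -/

/-- **GS-grade law: dilation + dispersion ≤ site-merit surplus over `M⋆` + `o(#B + ρ³)`.**  For every `ε > 0` there is `ρ₁`
such that for all `ρ ≥ ρ₁`, every Lennard-Jones ground state `y` and every centre `p`, the window `B = B(p,ρ)` satisfies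
`T₁(B) + T₂(B) ≤ (1/24)·Σ_{i∈B}(q_i + 24·e⋆) + ε·(#B + ρ³)`.  Inputs: the merit split and the window law
`gsWindow_excess_virial` (`X(B) ≤ ε(#B + ρ³)`, from the tree's trial-state ceiling p797612 and cross-term floor p775283). -/
theorem gsStrainCharges_le_surplus : ∀ ε : ℝ, 0 < ε → ∃ ρ₁ : ℝ, ∀ ρ : ℝ, ρ₁ ≤ ρ →
    ∀ (N : ℕ) (y : Fin N → EuclideanSpace ℝ (Fin 3)), IsGroundState lennardJones y → ∀ p : EuclideanSpace ℝ (Fin 3),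
      ((∑ i ∈ Finset.univ.filter (fun i : Fin N => dist (y i) p ≤ ρ), ∑ k ∈ (Finset.univ.filter (fun i : Fin N => dist (y i) p ≤
            ρ)).erase i, (dist (y i) (y k))⁻¹ ^ 12) - (∑ i ∈ Finset.univ.filter (fun i : Fin N => dist (y i) p ≤
            ρ), ∑ k ∈ (Finset.univ.filter (fun i : Fin N => dist (y i) p ≤ ρ)).erase i, (dist (y i) (y k))⁻¹ ^ 6)) ^ 2 / (24 *
            (∑ i ∈ Finset.univ.filter (fun i : Fin N => dist (y i) p ≤ ρ), ∑ k ∈ (Finset.univ.filter (fun i : Fin N => dist (y i) p ≤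
            ρ)).erase i, (dist (y i) (y k))⁻¹ ^ 12)) + (1 / 24) * ∑ i ∈ Finset.univ.filter (fun i : Fin N => dist (y i) p ≤
            ρ), (∑ k ∈ (Finset.univ.filter (fun i : Fin N => dist (y i) p ≤ ρ)).erase i, (dist (y i) (y k))⁻¹ ^ 12) *
            ((∑ k ∈ (Finset.univ.filter (fun i : Fin N => dist (y i) p ≤
            ρ)).erase i, (dist (y i) (y k))⁻¹ ^ 6) / (∑ k ∈ (Finset.univ.filter (fun i : Fin N => dist (y i) p ≤
            ρ)).erase i, (dist (y i) (y k))⁻¹ ^ 12) - (∑ i ∈ Finset.univ.filter (fun i : Fin N => dist (y i) p ≤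
            ρ), ∑ k ∈ (Finset.univ.filter (fun i : Fin N => dist (y i) p ≤
            ρ)).erase i, (dist (y i) (y k))⁻¹ ^ 6) / (∑ i ∈ Finset.univ.filter (fun i : Fin N => dist (y i) p ≤
            ρ), ∑ k ∈ (Finset.univ.filter (fun i : Fin N => dist (y i) p ≤ ρ)).erase i, (dist (y i) (y k))⁻¹ ^ 12)) ^ 2 ≤ (1 / 24) *
            ∑ i ∈ Finset.univ.filter (fun i : Fin N => dist (y i) p ≤ ρ), ((∑ k ∈ (Finset.univ.filter (fun i : Fin N => dist (y i) p ≤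
            ρ)).erase i, (dist (y i) (y k))⁻¹ ^ 6) ^ 2 / (∑ k ∈ (Finset.univ.filter (fun i : Fin N => dist (y i) p ≤
            ρ)).erase i, (dist (y i) (y k))⁻¹ ^ 12) + 24 * (⨅ Q : PeriodicConfiguration 3, Q.energyPerParticle lennardJones)) + ε *
            (((Finset.univ.filter (fun i : Fin N => dist (y i) p ≤ ρ)).card : ℝ) + ρ ^ 3) := by
  intro ε hε
  obtain ⟨ρ₁, h⟩ := gsWindow_excess_virial ε hε
  refine ⟨ρ₁, fun ρ hρ N y hGS p => ?_⟩
  obtain ⟨-, hX, -⟩ := h ρ hρ N y hGS p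
  have h3 := windowEnergy_three_terms y (Finset.univ.filter (fun i : Fin N => dist (y i) p ≤
        ρ)) (⨅ Q : PeriodicConfiguration 3, Q.energyPerParticle lennardJones)
  have hneg : (1 / 24) * ∑ i ∈ Finset.univ.filter (fun i : Fin N => dist (y i) p ≤ ρ), (-24 *
        (⨅ Q : PeriodicConfiguration 3, Q.energyPerParticle lennardJones) - (∑ k ∈ (Finset.univ.filter (fun i : Fin N => dist (y i) p ≤
        ρ)).erase i, (dist (y i) (y k))⁻¹ ^ 6) ^ 2 / (∑ k ∈ (Finset.univ.filter (fun i : Fin N => dist (y i) p ≤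
        ρ)).erase i, (dist (y i) (y k))⁻¹ ^ 12)) = -((1 / 24) * ∑ i ∈ Finset.univ.filter (fun i : Fin N => dist (y i) p ≤
        ρ), ((∑ k ∈ (Finset.univ.filter (fun i : Fin N => dist (y i) p ≤
        ρ)).erase i, (dist (y i) (y k))⁻¹ ^ 6) ^ 2 / (∑ k ∈ (Finset.univ.filter (fun i : Fin N => dist (y i) p ≤
        ρ)).erase i, (dist (y i) (y k))⁻¹ ^ 12) + 24 * (⨅ Q : PeriodicConfiguration 3, Q.energyPerParticle lennardJones))) := by
    rw [← mul_neg, ← Finset.sum_neg_distrib]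
    congr 1
    exact Finset.sum_congr rfl fun i _ => by ring
  linarith

/-- **`e⋆`-free GS law.**  Same, with the crystal merit replaced by `M₀ = −24q₀` for any `q₀ ≥ e⋆`:
`T₁(B) + T₂(B) ≤ (1/24)·Σ_{i∈B}(q_i + 24·q₀) + ε·(#B + ρ³)` — «in a large ground-state window, personal-scale dispersion is at
most the total site-merit surplus over `17.22` (with `q₀ = −0.7175`) plus `o(#B + ρ³)`». -/
theorem gsStrainCharges_le_surplus_free {q₀ : ℝ} (hq : (⨅ Q : PeriodicConfiguration 3, Q.energyPerParticle lennardJones) ≤ q₀) : ∀ ε : ℝ, 0 <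
      ε → ∃ ρ₁ : ℝ, ∀ ρ : ℝ, ρ₁ ≤ ρ →
    ∀ (N : ℕ) (y : Fin N → EuclideanSpace ℝ (Fin 3)), IsGroundState lennardJones y → ∀ p : EuclideanSpace ℝ (Fin 3),
      ((∑ i ∈ Finset.univ.filter (fun i : Fin N => dist (y i) p ≤ ρ), ∑ k ∈ (Finset.univ.filter (fun i : Fin N => dist (y i) p ≤
            ρ)).erase i, (dist (y i) (y k))⁻¹ ^ 12) - (∑ i ∈ Finset.univ.filter (fun i : Fin N => dist (y i) p ≤
            ρ), ∑ k ∈ (Finset.univ.filter (fun i : Fin N => dist (y i) p ≤ ρ)).erase i, (dist (y i) (y k))⁻¹ ^ 6)) ^ 2 / (24 *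
            (∑ i ∈ Finset.univ.filter (fun i : Fin N => dist (y i) p ≤ ρ), ∑ k ∈ (Finset.univ.filter (fun i : Fin N => dist (y i) p ≤
            ρ)).erase i, (dist (y i) (y k))⁻¹ ^ 12)) + (1 / 24) * ∑ i ∈ Finset.univ.filter (fun i : Fin N => dist (y i) p ≤
            ρ), (∑ k ∈ (Finset.univ.filter (fun i : Fin N => dist (y i) p ≤ ρ)).erase i, (dist (y i) (y k))⁻¹ ^ 12) *
            ((∑ k ∈ (Finset.univ.filter (fun i : Fin N => dist (y i) p ≤
            ρ)).erase i, (dist (y i) (y k))⁻¹ ^ 6) / (∑ k ∈ (Finset.univ.filter (fun i : Fin N => dist (y i) p ≤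
            ρ)).erase i, (dist (y i) (y k))⁻¹ ^ 12) - (∑ i ∈ Finset.univ.filter (fun i : Fin N => dist (y i) p ≤
            ρ), ∑ k ∈ (Finset.univ.filter (fun i : Fin N => dist (y i) p ≤
            ρ)).erase i, (dist (y i) (y k))⁻¹ ^ 6) / (∑ i ∈ Finset.univ.filter (fun i : Fin N => dist (y i) p ≤
            ρ), ∑ k ∈ (Finset.univ.filter (fun i : Fin N => dist (y i) p ≤ ρ)).erase i, (dist (y i) (y k))⁻¹ ^ 12)) ^ 2 ≤ (1 / 24) *
            ∑ i ∈ Finset.univ.filter (fun i : Fin N => dist (y i) p ≤ ρ), ((∑ k ∈ (Finset.univ.filter (fun i : Fin N => dist (y i) p ≤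
            ρ)).erase i, (dist (y i) (y k))⁻¹ ^ 6) ^ 2 / (∑ k ∈ (Finset.univ.filter (fun i : Fin N => dist (y i) p ≤
            ρ)).erase i, (dist (y i) (y k))⁻¹ ^ 12) + 24 * q₀) + ε * (((Finset.univ.filter (fun i : Fin N => dist (y i) p ≤ ρ)).card : ℝ) +
            ρ ^ 3) := by
  intro ε hε
  obtain ⟨ρ₁, h⟩ := gsStrainCharges_le_surplus ε hε
  refine ⟨ρ₁, fun ρ hρ N y hGS p => ?_⟩
  have h1 := h ρ hρ N y hGS p
  have hmono : (1 / 24) * ∑ i ∈ Finset.univ.filter (fun i : Fin N => dist (y i) p ≤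
        ρ), ((∑ k ∈ (Finset.univ.filter (fun i : Fin N => dist (y i) p ≤
        ρ)).erase i, (dist (y i) (y k))⁻¹ ^ 6) ^ 2 / (∑ k ∈ (Finset.univ.filter (fun i : Fin N => dist (y i) p ≤
        ρ)).erase i, (dist (y i) (y k))⁻¹ ^ 12) + 24 * (⨅ Q : PeriodicConfiguration 3, Q.energyPerParticle lennardJones)) ≤ (1 / 24) *
        ∑ i ∈ Finset.univ.filter (fun i : Fin N => dist (y i) p ≤ ρ), ((∑ k ∈ (Finset.univ.filter (fun i : Fin N => dist (y i) p ≤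
        ρ)).erase i, (dist (y i) (y k))⁻¹ ^ 6) ^ 2 / (∑ k ∈ (Finset.univ.filter (fun i : Fin N => dist (y i) p ≤
        ρ)).erase i, (dist (y i) (y k))⁻¹ ^ 12) + 24 * q₀) := by
    refine mul_le_mul_of_nonneg_left (Finset.sum_le_sum fun i _ => ?_) (by norm_num)
    linarith
  linarith

/-! ## §5 Counting form of the dispersion charge (abstract finsets) -/

/-- **Double counting.**  If every `i ∈ s` lies in at most `K` of the sets `P j ⊆ s` (`j ∈ J`) and `f ≥ 0` on `s`, then
`Σ_{j∈J} Σ_{i∈P j} f i ≤ K·Σ_{i∈s} f i`. -/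
theorem sum_sum_le_mul_sum_of_multiplicity {ι κ : Type*} (s : Finset ι) (J : Finset κ) (P : κ → Finset ι) (f : ι → ℝ)
    (K : ℕ) (hP : ∀ j ∈ J, P j ⊆ s) (hf : ∀ i ∈ s, 0 ≤ f i)
    (hK : ∀ i ∈ s, (J.filter fun j => i ∈ P j).card ≤ K) :
    ∑ j ∈ J, ∑ i ∈ P j, f i ≤ (K : ℝ) * ∑ i ∈ s, f i := by
  calc ∑ j ∈ J, ∑ i ∈ P j, f i = ∑ j ∈ J, ∑ i ∈ s, (if i ∈ P j then f i else 0) := by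
        refine Finset.sum_congr rfl fun j hj => ?_
        rw [← Finset.sum_filter]
        congr 1
        ext i
        simp only [Finset.mem_filter]
        exact ⟨fun h => ⟨hP j hj h, h⟩, fun h => h.2⟩
    _ = ∑ i ∈ s, ∑ j ∈ J, (if i ∈ P j then f i else 0) := Finset.sum_comm
    _ = ∑ i ∈ s, ((J.filter fun j => i ∈ P j).card : ℝ) * f i := by
        refine Finset.sum_congr rfl fun i _ => ?_
        rw [← Finset.sum_filter, Finset.sum_const, nsmul_eq_mul]
    _ ≤ ∑ i ∈ s, (K : ℝ) * f i := by
        refine Finset.sum_le_sum fun i hi => mul_le_mul_of_nonneg_right ?_ (hf i hi)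
        exact_mod_cast hK i hi
    _ = (K : ℝ) * ∑ i ∈ s, f i := by rw [Finset.mul_sum]

/-- Two values `≥ c` apart have total squared deviation `≥ c²/2` from any centre. -/
theorem sq_add_sq_ge_of_dist {u v m c : ℝ} (h : c ≤ |u - v|) (hc : 0 ≤ c) : c ^ 2 / 2 ≤ (u - m) ^ 2 + (v - m) ^ 2 := by
  have h1 : c ^ 2 ≤ (u - v) ^ 2 := by
    calc c ^ 2 ≤ |u - v| ^ 2 := pow_le_pow_left₀ hc h 2
      _ = (u - v) ^ 2 := sq_abs _
  nlinarith [sq_nonneg (u + v - 2 * m)]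

/-- **Dispersion from contrast (counting form).**  Weights `b ≥ 0` on `s`, values `u`, a finset `J` of charged indices; for
each `j ∈ J` a set `P j ⊆ s`, every `i ∈ s` lying in at most `K ≥ 1` of them, containing two distinct indices `i₁ j, i₂ j`
with `b ≥ β` and `|u(i₁ j) − u(i₂ j)| ≥ c`.  Then for EVERY centre `m`: `#J·βc²/(2K) ≤ Σ_{i∈s} b_i(u_i − m)²`. -/
theorem card_mul_le_dispersion {ι κ : Type*} (s : Finset ι) (J : Finset κ) (P : κ → Finset ι) (b u : ι → ℝ)
    (i₁ i₂ : κ → ι) {K : ℕ} {β c : ℝ} (m : ℝ) (hK1 : 1 ≤ K) (hβ : 0 ≤ β) (hc : 0 ≤ c)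
    (hP : ∀ j ∈ J, P j ⊆ s) (hb : ∀ i ∈ s, 0 ≤ b i)
    (hK : ∀ i ∈ s, (J.filter fun j => i ∈ P j).card ≤ K)
    (h1 : ∀ j ∈ J, i₁ j ∈ P j) (h2 : ∀ j ∈ J, i₂ j ∈ P j) (h12 : ∀ j ∈ J, i₁ j ≠ i₂ j)
    (hb1 : ∀ j ∈ J, β ≤ b (i₁ j)) (hb2 : ∀ j ∈ J, β ≤ b (i₂ j))
    (hcon : ∀ j ∈ J, c ≤ |u (i₁ j) - u (i₂ j)|) :
    (J.card : ℝ) * (β * c ^ 2 / (2 * K)) ≤ ∑ i ∈ s, b i * (u i - m) ^ 2 := by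
  have hK0 : (0 : ℝ) < K := by exact_mod_cast hK1
  have hpair : ∀ j ∈ J, β * c ^ 2 / 2 ≤ ∑ i ∈ P j, b i * (u i - m) ^ 2 := by
    intro j hj
    have hsub : ({i₁ j, i₂ j} : Finset ι) ⊆ P j := by
      intro i hi
      rcases Finset.mem_insert.1 hi with rfl | hi
      · exact h1 j hj
      · rw [Finset.mem_singleton] at hi; rw [hi]; exact h2 j hj
    have hPs := hP j hj
    calc β * c ^ 2 / 2 = β * (c ^ 2 / 2) := by ring
      _ ≤ β * ((u (i₁ j) - m) ^ 2 + (u (i₂ j) - m) ^ 2) :=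
          mul_le_mul_of_nonneg_left (sq_add_sq_ge_of_dist (hcon j hj) hc) hβ
      _ = β * (u (i₁ j) - m) ^ 2 + β * (u (i₂ j) - m) ^ 2 := by ring
      _ ≤ b (i₁ j) * (u (i₁ j) - m) ^ 2 + b (i₂ j) * (u (i₂ j) - m) ^ 2 :=
          add_le_add (mul_le_mul_of_nonneg_right (hb1 j hj) (sq_nonneg _))
            (mul_le_mul_of_nonneg_right (hb2 j hj) (sq_nonneg _))
      _ = ∑ i ∈ ({i₁ j, i₂ j} : Finset ι), b i * (u i - m) ^ 2 := by
          rw [Finset.sum_pair (h12 j hj)]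
      _ ≤ ∑ i ∈ P j, b i * (u i - m) ^ 2 :=
          Finset.sum_le_sum_of_subset_of_nonneg hsub fun i hi _ => mul_nonneg (hb i (hPs hi)) (sq_nonneg _)
  have hsum : (J.card : ℝ) * (β * c ^ 2 / 2) ≤ ∑ j ∈ J, ∑ i ∈ P j, b i * (u i - m) ^ 2 := by
    have := Finset.card_nsmul_le_sum J (fun j => ∑ i ∈ P j, b i * (u i - m) ^ 2) (β * c ^ 2 / 2) hpair
    simpa [nsmul_eq_mul] using this
  have hmult := sum_sum_le_mul_sum_of_multiplicity s J P (fun i => b i * (u i - m) ^ 2) K hP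
    (fun i hi => mul_nonneg (hb i hi) (sq_nonneg _)) hK
  have : (J.card : ℝ) * (β * c ^ 2 / (2 * K)) = (J.card : ℝ) * (β * c ^ 2 / 2) / K := by
    field_simp
  rw [this, div_le_iff₀ hK0]
  calc (J.card : ℝ) * (β * c ^ 2 / 2) ≤ ∑ j ∈ J, ∑ i ∈ P j, b i * (u i - m) ^ 2 := hsum
    _ ≤ (K : ℝ) * ∑ i ∈ s, b i * (u i - m) ^ 2 := hmult
    _ = (∑ i ∈ s, b i * (u i - m) ^ 2) * K := by ring

end Summit.AtomisticToContinuum.Crystallization.Theorems.ContactSaturationLadderDispersionCharge
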